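import Literature.NumberTheory.Automorphic.UnitaryLatticeTreeEulerRelation   -- ★ root star = `K₀·N₁` (`mem_neighborSet_root_iff_exists_mem_unitaryInt`), `latticeGraphIso_apply_eq_self_iff`
import Literature.NumberTheory.Automorphic.UnitaryLatticeTreeFixedStar       -- ★ `mapGL_mul_N₁_eq_of_residually_scalar` (a residually scalar `γ ∈ K₀` fixes every `κ·N₁`)
import HarnessLib

/-!
# R90 · S6 «Ch. 14.1–14.5 stable trace formula» — card W8-i″, FILE 3a (RESIDUAL VALUE «CENTRAL»): a RESIDUALLY SCALAR `k ∈ K₀` fixes the WHOLE star of the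
# hyperspecial root — `#{w ∈ star(L₀) | k·w = w} = #star(L₀)` (`= q³ + 1` at an inert place) (`Theorems/R90S6ResidualStarFixedScalar.lean`)

Cell `hodgecm-mathlib`, crux H413 (`stmt-HodgeConjecture-24833`), route of record `HCCMUnconditional`; programme R90-TF, section S6 (base `R90-C14`), seat R90-C14-p05 (g0);
S6 dealer R90-C14-plan (g2) 23:57:28Z «FILE 3 = the per-reduction-type VALUES of the residual count … state each value WITH its exact hypothesis on k̄ … one public theorem
per value» (DAG r5 row E1.3.5.2.4).  Helper lane `--supports stmt-HodgeConjecture-24833 --as helper`; ONE theorem (no definition, no instance, no notation, no named fact,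
no `sorry`); imports = ★ `Literature.NumberTheory.Automorphic.UnitaryLatticeTreeEulerRelation` + ★ `Literature.NumberTheory.Automorphic.UnitaryLatticeTreeFixedStar` + HarnessLib.

THE MATHEMATICS [Tits1979, §3.5; BruhatTits1972, §10; Serre1980Trees, II.1.1].  `K` a valued field with an unramified datum `hd : UnramifiedLocalConjDatum σ ϖ`,
`U = U(σ, J₀)(K)`, `K₀ = U ∩ GL₃(𝒪)`, `L₀ = 𝒪³` the self-dual root, its star `= {κ·N₁ | κ ∈ K₀}` (★ `mem_neighborSet_root_iff_exists_mem_unitaryInt`).  If `k ∈ K₀` is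
RESIDUALLY SCALAR — `|k_{ij} − c·δ_{ij}| < 1` for all `i, j`, some `c` with `|c| = 1` (e.g. `k ∈ K₀(1)`, `c = 1`; or `k = ζ·k′`, `ζ ∈ E¹`, `k′ ∈ K₀(1)`) — then `k̄` acts
trivially on `ℙ(𝓀³)`, so `k` fixes every vertex `κ·N₁` of the star (★ `mapGL_mul_N₁_eq_of_residually_scalar`): **the `k`-fixed part of the star is the whole star**, and its
`Set.ncard` is `#star(L₀)` (`= q_v³ + 1` at an inert place, ★ `ncard_neighborSet_of_isSelfDualLattice_inert`).  This is the value «central ↦ q³+1» of the residual census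
`s(x)` in ★ FILE 1 `R90.S6.natCard_fixedBy_special_add_eq_one_add_sum` ∘ ★ FILE 2 `R90.S6.natCard_fixedBy_star_eq_ncard_fixed_neighborSet_root` — every interior fixed
hyperspecial vertex `x` of a deep elliptic `γ` (local monodromy `k_x ∈ ζ·K₀(1)`) contributes `q³ + 1` special neighbours.
HONEST LABEL: lattice bookkeeping over ★ organs; count-neutral until the per-literal censuses + W8-f consume it; proves no printed statement.  HC_CM is proved only modulo the
7 printed citations (2 remaining named inputs: hLiu418 = stmt-HodgeConjecture-24832, h413 = stmt-HodgeConjecture-24833) until rung 0 closes.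
-/

set_option autoImplicit false
-- the mandated namespace repeats the single-problem summit's segment (`HodgeConjecture.HodgeConjecture`)
set_option linter.dupNamespace false

noncomputable section

open Literature.NumberTheory.Automorphic Literature.NumberTheory.Automorphic.HermitianLattice Literature.NumberTheory.Automorphic.UnitaryGroup
open Literature.NumberTheory.Automorphic.UnitaryLatticeTree
open scoped Matrix MatrixGroups WithZero Valued

namespace Summit.HodgeConjecture.HodgeConjecture.R90.S6

/-- **W8-i″ FILE 3a — A RESIDUALLY SCALAR `k ∈ K₀` FIXES THE WHOLE STAR OF THE ROOT: `#{w ∈ star(L₀) | k·w = w} = #star(L₀)`.**  For an unramified datum `hd` and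
`k ∈ K₀ = U(σ,J₀) ∩ GL₃(𝒪)` with `|k_{ij} − c·δ_{ij}| < 1` for all `i, j` (`|c| = 1`), the `k`-fixed vertices of the star of the root `L₀ = 𝒪³` in ★ `latticeGraph σ ϖ J₀`
are ALL of them (★ `mapGL_mul_N₁_eq_of_residually_scalar` on `star(L₀) = K₀·N₁`), so the fixed count of ★ FILE 2 equals `(star L₀).ncard` (`= q_v³ + 1` at an inert place
by ★ `ncard_neighborSet_of_isSelfDualLattice_inert`). [cite: Tits1979, §3.5] [cite: BruhatTits1972, §10] [cite: Serre1980Trees, II.1.1] -/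
theorem ncard_fixed_neighborSet_root_of_residually_scalar {K : Type*} [Field K] [Valued K ℤᵐ⁰]
    {σ : K →+* K} {ϖ : K} (hd : UnramifiedLocalConjDatum σ ϖ)
    (k : ↥(unitaryGroupOfForm σ ((StdForm.antidiagonal 3).over K))) (hk : k ∈ unitaryInt σ ((StdForm.antidiagonal 3).over K))
    {c : K} (hc : Valued.v c = 1)
    (hkc : ∀ i j, Valued.v (((k : GL (Fin 3) K) : Matrix (Fin 3) (Fin 3) K) i j - c * (1 : Matrix (Fin 3) (Fin 3) K) i j) < 1) :
    {w : {M : Submodule 𝒪[K] (Fin 3 → K) // IsVertex σ ϖ ((StdForm.antidiagonal 3).over K) M} |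
        w ∈ (latticeGraph σ ϖ ((StdForm.antidiagonal 3).over K)).neighborSet ⟨stdLattice K 3, 0, isSelfDualLattice_stdLattice_three hd⟩ ∧
          latticeGraphIso σ ϖ ((StdForm.antidiagonal 3).over K) k w = w}.ncard =
      ((latticeGraph σ ϖ ((StdForm.antidiagonal 3).over K)).neighborSet ⟨stdLattice K 3, 0, isSelfDualLattice_stdLattice_three hd⟩).ncard := by
  congr 1
  ext w
  simp only [Set.mem_setOf_eq, SimpleGraph.mem_neighborSet]
  constructor
  · exact fun h => h.1
  · intro hw
    refine ⟨hw, ?_⟩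
    obtain ⟨κ, hκ, hw1⟩ := (mem_neighborSet_root_iff_exists_mem_unitaryInt hd w).1 hw
    rw [latticeGraphIso_apply_eq_self_iff, hw1]
    exact mapGL_mul_N₁_eq_of_residually_scalar hd.vσ hd.vϖ hk hκ hc hkc

end Summit.HodgeConjecture.HodgeConjecture.R90.S6

end
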